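import Literature.AlgebraicGeometry.Morphisms.RelativelyVeryAmpleNearFibre
import Literature.AlgebraicGeometry.Morphisms.FibreAfterAwayBaseChange
import Literature.AlgebraicGeometry.Motives.GeneratingSectionsOfCocycleComap
import Literature.AlgebraicGeometry.Motives.GeneratingSectionsOfLineBundle
import HarnessLib

/-!
# EGA III 4.7.1 (assembly): sections of a trivialised line bundle embedding the fibre embed a neighbourhood

Topic `AlgebraicGeometry/Morphisms`; namespace `Literature.AlgebraicGeometry.Morphisms`. THEOREMS ONLY (no definition, no named
fact, no instance, no `sorry`).

Let `f : X → Spec A` be PROPER, `𝔭 ∈ Spec A`, and let `S : CocycleSections (Fin (n+1)) W` be `n + 1` sections of a line bundle on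
`X` trivialised on the opens `W a` (★ `Motives/GeneratingSectionsOfCocycle`: coefficients `c i a ∈ Γ(X, W a)`; from an
`X.Modules` line bundle with a rank-one frame system and global sections by ★ `CocycleSections.ofFrameSystem`). Suppose the
sections GENERATE along the fibre over `𝔭` (`f⁻¹(𝔭) ⊆ ⋃_{i,a} X_{c i a}`) and that on the fibre `X₀ = X ×_A κ(𝔭)` (any cartesian
square over `Spec (A → κ(𝔭))`) the morphism `X₀ → ℙⁿ_{κ(𝔭)}` they define (★ `ofCocycleSections` of the restricted
coefficients, ★ `GeneratingSections.toProj`) is a CLOSED IMMERSION («`𝓛_𝔭` very ample with these sections»). Then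
(**`exists_isClosedImmersion_toProj_ofCocycleSections_away`**): for some `g ∉ 𝔭` the sections generate on `X_g = X ×_A A_g`,
and for some `r ∈ A_g` outside the prime `𝔭A_g` the datum restricted to `X_g ×_{A_g} (A_g)_r` defines a CLOSED IMMERSION into
`ℙⁿ_{(A_g)_r}` — the sections make `𝓛` very ample relative to the affine neighbourhood `Spec (A_g)_r` of `𝔭`. This is
EGA III 4.7.1 for `(𝓛, t₀,…,tₙ)` modulo the cohomological input producing the global sections `tᵢ` from the fibre's
(★ `Morphisms/SectionsLiftOfFibreVanishing(AtPrime)`).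

Road (all ★): tube lemma `exists_away_preimage_basicOpen_le_of_isClosedMap` ⇒ `g`; `CocycleSections.comap` along
`X_g → X` and `ofCocycleSections` ⇒ the datum `D_g` on `X_g`; `FibreAfterAwayBaseChange` ⇒ the fibre of `X_g` over `𝔭A_g`
presented by the ORIGINAL `X₀` over `κ(𝔭)` (`HX_g`, `σ`, `hσ`); `ofCocycleSections_comap` (B-p19 (g14)) along the factorisation
`X₀ → X_g → X` ⇒ `D_g|_{X₀}` is the fibre datum; `exists_isClosedImmersion_toProj_comap_away_of_algebra` (EGA III 4.6.7 (ii) +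
`ℙⁿ` base change) concludes.

* `ofCocycleSections_comap_of_comp_eq` — the datum of restricted coefficients, pulled back along `h` with `h ≫ j = i₀`, is the
  datum of the coefficients restricted along `i₀`;
* `iSup_basicOpen_comap_coeff_fibre_eq_top` — generation along `f⁻¹(𝔭)` ⇒ generation on the fibre `X₀` (the `hcov₀` input);
* **`exists_isClosedImmersion_toProj_ofCocycleSections_away`** — the statement above;
* **`exists_isClosedImmersion_toProj_ofFrameSystem_away`** (edition 2) — the same for `E : X.Modules` with a rank-one frame system
  and global sections `t` (★ `CocycleSections.ofFrameSystem`, generation tested by ★ `coeffAt`).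

Cell `hodgecm-mathlib`, F-DAG (h2) leaf (B) = F-2a assembly. Count-neutral (HC_CM is proved only modulo the 7 printed citations
until rung 0 closes).

## References
* A. Grothendieck, J. Dieudonné, *EGA III₁* (1961), Thm. 4.7.1, Prop. 4.6.7 (ii). [EGAIII1]
* R. Hartshorne, *Algebraic Geometry* (1977), II Thm. 7.1, III Thm. 12.11 (context). [Hartshorne1977]
-/

universe v u

open CategoryTheory CategoryTheory.Limits AlgebraicGeometry TopologicalSpace
open Literature.AlgebraicGeometry.Motives Literature.AlgebraicGeometry.Motives.Segre
open Literature.AlgebraicGeometry.Motives.GeneratingSections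

namespace Literature.AlgebraicGeometry.Morphisms

attribute [local instance] MvPolynomial.gradedAlgebra

/-- **The datum of restricted coefficients along a factorisation.** For coefficient data `S` trivialised on `W` over `X`, a
morphism `j : X' → X` along which the coefficients generate, and `h : T → X'` with `h ≫ j = i₀` (and the coefficients
restricted along `i₀` generating on `T`): the datum of `S|_{X'}` pulled back along `h` IS the datum of `S|_T` (B-p19's
`ofCocycleSections_comap` after `subst`). [cite: Hartshorne1977, II Thm. 7.1] -/
theorem ofCocycleSections_comap_of_comp_eq {ι : Type} {α : Type v} {X X' T : Scheme.{u}} {W : α → X.Opens}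
    (S : CocycleSections ι W) (j : X' ⟶ X) (h : T ⟶ X') (i₀ : T ⟶ X) (e : h ≫ j = i₀)
    (hcov' : ⨆ i, ⨆ a, X'.basicOpen ((S.comap j).coeff i a) = ⊤)
    (hcov₀ : ⨆ i, ⨆ a, T.basicOpen ((S.comap i₀).coeff i a) = ⊤) :
    (ofCocycleSections (fun a => j ⁻¹ᵁ W a) (S.comap j) hcov').comap h =
      ofCocycleSections (fun a => i₀ ⁻¹ᵁ W a) (S.comap i₀) hcov₀ := by
  subst e
  exact (ofCocycleSections_comap h (S.comap j) hcov').symm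

/-- **Generation along the fibre ⇒ generation on the fibre.** If the coefficients' non-vanishing loci cover `f⁻¹(𝔭)`, then
their restrictions cover the fibre `X₀ = X ×_A κ(𝔭)` (every point of `Spec κ(𝔭)` maps to `𝔭`: the prime of a field is `⊥`
and `ker (A → κ(𝔭)) = 𝔭`). Supplies the hypothesis `hcov₀` of `exists_isClosedImmersion_toProj_ofCocycleSections_away`.
[cite: EGAIII1, Prop. 4.6.7 (ii)] -/
theorem iSup_basicOpen_comap_coeff_fibre_eq_top {A : Type u} [CommRing A] {X : Scheme.{u}} (f : X ⟶ Spec (.of A))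
    {ι : Type} {α : Type v} {W : α → X.Opens} (S : CocycleSections ι W) (𝔭 : PrimeSpectrum A)
    {X₀ : Scheme.{u}} {iX : X₀ ⟶ X} {f₀ : X₀ ⟶ Spec (.of 𝔭.asIdeal.ResidueField)}
    (HX : IsPullback iX f₀ f (Spec.map (CommRingCat.ofHom (algebraMap A 𝔭.asIdeal.ResidueField))))
    (hgen : ∀ x : X, f x = 𝔭 → x ∈ ⨆ i, ⨆ a, X.basicOpen (S.coeff i a)) :
    ⨆ i, ⨆ a, X₀.basicOpen ((S.comap iX).coeff i a) = ⊤ := by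
  simp_rw [CocycleSections.basicOpen_comap_coeff, ← Scheme.Hom.preimage_iSup]
  rw [← top_le_iff]
  intro x _
  show iX x ∈ ⨆ i, ⨆ a, X.basicOpen (S.coeff i a)
  apply hgen
  rw [← Scheme.Hom.comp_apply, HX.w, Scheme.Hom.comp_apply]
  show PrimeSpectrum.comap (algebraMap A 𝔭.asIdeal.ResidueField) (f₀ x) = 𝔭
  ext1
  rw [PrimeSpectrum.comap_asIdeal, Ideal.eq_bot_of_prime (f₀ x).asIdeal, ← RingHom.ker_eq_comap_bot,
    Ideal.ker_algebraMap_residueField]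

/-- **EGA III 4.7.1 (assembly, generating-sections currency).** `f : X → Spec A` proper; `S` = `n + 1` sections of a line bundle on
`X` trivialised on the `W a` (coefficients); the sections generate along `f⁻¹(𝔭)`; on the fibre `X₀ = X ×_A κ(𝔭)` the morphism to
`ℙⁿ_{κ(𝔭)}` of the restricted coefficients is a closed immersion. THEN: for some `g ∉ 𝔭` the restricted coefficients generate on
`X_g = X ×_A A_g`, and for the prime `𝔭₁ = 𝔭A_g` and some `r ∉ 𝔭₁` the datum on `X_g` restricted to `X_g ×_{A_g} (A_g)_r`
defines a CLOSED IMMERSION into `ℙⁿ_{(A_g)_r}` (`𝓛` is very ample, with these sections, relative to the affine neighbourhood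
`Spec (A_g)_r` of `𝔭`). [cite: EGAIII1, Thm. 4.7.1] [cite: EGAIII1, Prop. 4.6.7 (ii)] -/
theorem exists_isClosedImmersion_toProj_ofCocycleSections_away {A : Type u} [CommRing A] {n : ℕ} {X : Scheme.{u}}
    (f : X ⟶ Spec (.of A)) [IsProper f] {α : Type v} {W : α → X.Opens} (S : CocycleSections (Fin (n + 1)) W)
    (𝔭 : PrimeSpectrum A) {X₀ : Scheme.{u}} {iX : X₀ ⟶ X} {f₀ : X₀ ⟶ Spec (.of 𝔭.asIdeal.ResidueField)}
    (HX : IsPullback iX f₀ f (Spec.map (CommRingCat.ofHom (algebraMap A 𝔭.asIdeal.ResidueField))))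
    (hgen : ∀ x : X, f x = 𝔭 → x ∈ ⨆ i, ⨆ a, X.basicOpen (S.coeff i a))
    (hcov₀ : ⨆ i, ⨆ a, X₀.basicOpen ((S.comap iX).coeff i a) = ⊤)
    (H : IsClosedImmersion ((ofCocycleSections (fun a => iX ⁻¹ᵁ W a) (S.comap iX) hcov₀).toProj f₀)) :
    ∃ (g : A), g ∉ 𝔭.asIdeal ∧
      ∃ (hcovg : ⨆ i, ⨆ a, (pullback f (Spec.map (CommRingCat.ofHom (algebraMap A (Localization.Away g))))).basicOpen
          ((S.comap (pullback.fst f (Spec.map (CommRingCat.ofHom (algebraMap A (Localization.Away g)))))).coeff i a) = ⊤),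
      ∃ 𝔭₁ : PrimeSpectrum (Localization.Away g), PrimeSpectrum.comap (algebraMap A (Localization.Away g)) 𝔭₁ = 𝔭 ∧
      ∃ r : Localization.Away g, r ∉ 𝔭₁.asIdeal ∧ IsClosedImmersion
        (((ofCocycleSections (fun a => (pullback.fst f (Spec.map (CommRingCat.ofHom (algebraMap A (Localization.Away g))))) ⁻¹ᵁ W a)
            (S.comap (pullback.fst f (Spec.map (CommRingCat.ofHom (algebraMap A (Localization.Away g)))))) hcovg).comap
          (pullback.fst (pullback.snd f (Spec.map (CommRingCat.ofHom (algebraMap A (Localization.Away g)))))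
            (Spec.map (CommRingCat.ofHom (algebraMap (Localization.Away g) (Localization.Away r)))))).toProj
          (pullback.snd (pullback.snd f (Spec.map (CommRingCat.ofHom (algebraMap A (Localization.Away g)))))
            (Spec.map (CommRingCat.ofHom (algebraMap (Localization.Away g) (Localization.Away r)))))) := by
  -- Step 1: the sections generate on `f⁻¹ D(g)` for some `g ∉ 𝔭` (tube lemma for the closed map `f`)
  obtain ⟨g, hg, hle⟩ := exists_away_preimage_basicOpen_le_of_isClosedMap f f.isClosedMap
    (⨆ i, ⨆ a, X.basicOpen (S.coeff i a)) 𝔭 hgen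
  -- Step 2: base change to `A_g`
  set ιg := Spec.map (CommRingCat.ofHom (algebraMap A (Localization.Away g))) with hιg
  set j := pullback.fst f ιg with hj
  set fg := pullback.snd f ιg with hfg
  haveI : IsProper fg := MorphismProperty.pullback_snd (P := @IsProper) f ιg inferInstance
  have hcovg : ⨆ i, ⨆ a, (pullback f ιg).basicOpen ((S.comap j).coeff i a) = ⊤ := by
    simp_rw [CocycleSections.basicOpen_comap_coeff, ← Scheme.Hom.preimage_iSup]
    rw [← top_le_iff]
    intro x _
    show j x ∈ ⨆ i, ⨆ a, X.basicOpen (S.coeff i a)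
    apply hle
    show f (j x) ∈ PrimeSpectrum.basicOpen g
    rw [← Scheme.Hom.comp_apply, hj, pullback.condition, Scheme.Hom.comp_apply]
    have hx : ιg (fg x) ∈ Set.range (PrimeSpectrum.comap (algebraMap A (Localization.Away g))) := ⟨fg x, rfl⟩
    rw [PrimeSpectrum.localization_away_comap_range (Localization.Away g) g] at hx
    exact hx
  refine ⟨g, hg, hcovg, ?_⟩
  -- Step 3: the prime `𝔭₁ = 𝔭A_g` and the fibre of `X_g` over it, presented over `κ(𝔭)`
  obtain ⟨𝔭₁, h𝔭₁⟩ := exists_primeSpectrum_away_comap_eq 𝔭 g hg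
  refine ⟨𝔭₁, h𝔭₁, ?_⟩
  letI : Algebra (Localization.Away g) 𝔭.asIdeal.ResidueField :=
    (IsLocalization.Away.lift g (S := Localization.Away g) (isUnit_algebraMap_residueField_of_not_mem 𝔭 g hg)).toAlgebra
  obtain ⟨σ, hσ⟩ := exists_residueField_factor_awayLift 𝔭 g hg 𝔭₁ h𝔭₁
  have w := comp_eq_of_isPullback_fibre 𝔭 g hg f HX
  have HXg := isPullback_fibre_awayBaseChange 𝔭 g hg f HX w
  -- Step 4: the datum on `X_g` restricts on `X₀` to the fibre datum
  have hfac : pullback.lift iX (f₀ ≫ Spec.map (CommRingCat.ofHom (IsLocalization.Away.lift g (S := Localization.Away g)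
      (isUnit_algebraMap_residueField_of_not_mem 𝔭 g hg)))) w ≫ j = iX := pullback.lift_fst _ _ _
  have H' : IsClosedImmersion (((ofCocycleSections (fun a => j ⁻¹ᵁ W a) (S.comap j) hcovg).comap
      (pullback.lift iX (f₀ ≫ Spec.map (CommRingCat.ofHom (IsLocalization.Away.lift g (S := Localization.Away g)
        (isUnit_algebraMap_residueField_of_not_mem 𝔭 g hg)))) w)).toProj f₀) := by
    rw [ofCocycleSections_comap_of_comp_eq S j _ iX hfac hcovg hcov₀]
    exact H
  -- Step 5: EGA III 4.6.7 (ii) / 4.7.1 core over the base `A_g`, fibre over `κ(𝔭)`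
  exact exists_isClosedImmersion_toProj_comap_away_of_algebra fg 𝔭.asIdeal.ResidueField 𝔭₁ σ hσ
    (ofCocycleSections (fun a => j ⁻¹ᵁ W a) (S.comap j) hcovg) HXg H'

/-- **EGA III 4.7.1 for a line bundle `E : X.Modules` with global sections (edition 2).** `f : X → Spec A` proper, `E` an
`𝒪_X`-module with a rank-one frame system `F` (a line bundle with chosen local generators), `t₀,…,tₙ ∈ Γ(X, E)` global
sections which generate `E` along the fibre over `𝔭` (tested in the generator at each point, ★ `coeffAt`) and whose restriction
embeds the fibre `X₀ = X ×_A κ(𝔭)` into `ℙⁿ_{κ(𝔭)}`. Then they make `E` very ample relative to an affine neighbourhood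
`Spec (A_g)_r` of `𝔭`: the datum restricted to `X_g ×_{A_g} (A_g)_r` is a closed immersion into `ℙⁿ`
(`exists_isClosedImmersion_toProj_ofCocycleSections_away` for ★ `CocycleSections.ofFrameSystem F h1 t`). [cite: EGAIII1, Thm. 4.7.1] -/
theorem exists_isClosedImmersion_toProj_ofFrameSystem_away {A : Type u} [CommRing A] {n : ℕ} {X : Scheme.{u}}
    (f : X ⟶ Spec (.of A)) [IsProper f] {E : X.Modules} (F : Modules.FrameSystem E) (h1 : ∀ x, F.rank x = 1)
    (t : Fin (n + 1) → Γ(E, ⊤)) (𝔭 : PrimeSpectrum A) {X₀ : Scheme.{u}} {iX : X₀ ⟶ X}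
    {f₀ : X₀ ⟶ Spec (.of 𝔭.asIdeal.ResidueField)}
    (HX : IsPullback iX f₀ f (Spec.map (CommRingCat.ofHom (algebraMap A 𝔭.asIdeal.ResidueField))))
    (hgen : ∀ x : X, f x = 𝔭 → ∃ i, x ∈ X.basicOpen (coeffAt F h1 t i x))
    (hcov₀ : ⨆ i, ⨆ a, X₀.basicOpen (((CocycleSections.ofFrameSystem F h1 t).comap iX).coeff i a) = ⊤)
    (H : IsClosedImmersion
      ((ofCocycleSections (fun a => iX ⁻¹ᵁ F.U a) ((CocycleSections.ofFrameSystem F h1 t).comap iX) hcov₀).toProj f₀)) :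
    ∃ (g : A), g ∉ 𝔭.asIdeal ∧
      ∃ (hcovg : ⨆ i, ⨆ a, (pullback f (Spec.map (CommRingCat.ofHom (algebraMap A (Localization.Away g))))).basicOpen
          (((CocycleSections.ofFrameSystem F h1 t).comap
            (pullback.fst f (Spec.map (CommRingCat.ofHom (algebraMap A (Localization.Away g)))))).coeff i a) = ⊤),
      ∃ 𝔭₁ : PrimeSpectrum (Localization.Away g), PrimeSpectrum.comap (algebraMap A (Localization.Away g)) 𝔭₁ = 𝔭 ∧
      ∃ r : Localization.Away g, r ∉ 𝔭₁.asIdeal ∧ IsClosedImmersion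
        (((ofCocycleSections (fun a => (pullback.fst f (Spec.map (CommRingCat.ofHom (algebraMap A (Localization.Away g))))) ⁻¹ᵁ F.U a)
            ((CocycleSections.ofFrameSystem F h1 t).comap
              (pullback.fst f (Spec.map (CommRingCat.ofHom (algebraMap A (Localization.Away g)))))) hcovg).comap
          (pullback.fst (pullback.snd f (Spec.map (CommRingCat.ofHom (algebraMap A (Localization.Away g)))))
            (Spec.map (CommRingCat.ofHom (algebraMap (Localization.Away g) (Localization.Away r)))))).toProj
          (pullback.snd (pullback.snd f (Spec.map (CommRingCat.ofHom (algebraMap A (Localization.Away g)))))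
            (Spec.map (CommRingCat.ofHom (algebraMap (Localization.Away g) (Localization.Away r)))))) :=
  exists_isClosedImmersion_toProj_ofCocycleSections_away f (CocycleSections.ofFrameSystem F h1 t) 𝔭 HX
    (fun x hx ↦ by
      obtain ⟨i, hi⟩ := hgen x hx
      exact Opens.mem_iSup.mpr ⟨i, Opens.mem_iSup.mpr ⟨x, hi⟩⟩) hcov₀ H

end Literature.AlgebraicGeometry.Morphisms
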